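import Summits.AtomisticToContinuum.BoseEinsteinCondensation.Theorems.BECInsertionCorrectorCorrectorClosureResponseDictionarySin
import Literature.MathematicalPhysics.QuantumManyBody.LatticePowerSums
import HarnessLib

/-!
# Crux `CorrectorClosure` (stmt-AtomisticToContinuum-12058), line `residue-area-law` —
# stub `stub_firstCorrectorBound`, auxiliary file 3: the per-mode dictionary and the lattice sum

Supports (does not close) stmt-AtomisticToContinuum-12058, route `BECInsertionCorrector`.
* `responseDictionary_fk` — K1 (`StaticResponseBound`) in `H₋₁` currency for an ARBITRARY continuous
  torus Feynman–Kac ground state `Θ₀` of the `N`-body bath in the box `L = sideLength ρ (N+1)`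
  (the landed `stub_responseDictionary` / `responseDictionary_sin` are stated for the canonical
  witness `periodicFKGroundState`; the proofs are theirs verbatim, through
  `hMinusOneSqW_le_of_fk_staticResponse` and `staticResponse_sin_of_cos`), with the denominator
  `max(ρ'a, |p_k|²)` already replaced by `|p_k|² = (2π/L)²|k|²`: both density waves
  `∑ⱼ cos(p_k·xⱼ)`, `∑ⱼ sin(p_k·xⱼ)` have `‖·‖²₋₁ ≤ C N / |p_k|²`.
* `sum_sq_div_nsq_le` — the elementary lattice bound: if `|c_k| ≤ A` for all `k` and
  `∑_{k ∈ T} c_k² ≤ P` for all finite `T`, then `∑_{k ∈ T} c_k²/|k|² ≤ 96 K₀ A² + P/K₀²` for every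
  finite `T ∌ 0` and `K₀ ≥ 1` (shells `|k|∞ ≤ K₀` by `sum_inv_supNorm_sq_le`, the rest by `|k|² ≥ K₀²`).
-/

noncomputable section

open MeasureTheory Filter Finset
open scoped ENNReal NNReal BigOperators

namespace Summit.AtomisticToContinuum.BoseEinsteinCondensation.Theorems.CorrectorClosure.ResidueAreaLaw

open Literature.MathematicalPhysics.QuantumManyBody.BoseGas
open Summit.AtomisticToContinuum.BoseEinsteinCondensation.Theses.BECInsertionCorrector
open Summit.AtomisticToContinuum.BoseEinsteinCondensation.Theorems.CorrectorClosure.Negative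
  (sideLength_succ_pos)
open Summit.AtomisticToContinuum.BoseEinsteinCondensation.Theorems.CorrectorClosure.HealingScaleKacInsertion.ResponseDictionary

variable {N : ℕ}

/-! ### K1 in `H₋₁` currency for an arbitrary FK ground state of the bath -/

/-- **The per-mode dictionary for an arbitrary bath ground state.** `StaticResponseBound` gives,
for every repulsive finite-range `v`, thresholds `ρ₁ > 0`, `C > 0` such that for `0 < ρ < ρ₁`,
`N ≥ 1`, `L = sideLength ρ (N+1)` with bounded `v^per`, and EVERY continuous torus Feynman–Kac
ground state `Θ₀` of the `N`-body bath in that box, the cosine and sine density waves of every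
frequency `k ≠ 0` satisfy `‖∑ⱼ cos(p_k·xⱼ)‖²₋₁, ‖∑ⱼ sin(p_k·xⱼ)‖²₋₁ ≤ C N / |p_k|²`,
`p_k = 2πk/L` (K1 for the bath at density `ρN/(N+1)` in the same box, `sideLength_bath`;
`max(ρ'a, |p_k|²) ≥ |p_k|²`). [folklore] -/
theorem responseDictionary_fk (hK1 : StaticResponseBound) (v : ℝ → ℝ≥0∞)
    (hv : IsRepulsiveFiniteRange v) :
    ∃ ρ₁ : ℝ, 0 < ρ₁ ∧ ∃ C : ℝ, 0 < C ∧ ∀ ρ : ℝ, 0 < ρ → ρ < ρ₁ → ∀ N : ℕ, 1 ≤ N →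
      ∀ L : ℝ, L = sideLength ρ (N + 1) →
      (∃ C' : ℝ≥0, ∀ x, periodizedPotential v L x ≤ C') →
      ∀ Θ₀ : Config N → ℝ, IsPeriodicGroundStateFK v L Θ₀ → Continuous Θ₀ →
      ∀ k : Fin 3 → ℤ, k ≠ 0 →
        hMinusOneSqW L Θ₀
            (fun X : Config N => ∑ j, Real.cos (2 * Real.pi / L * ∑ i, (k i : ℝ) * X j i)) ≤
          ENNReal.ofReal (C * N / ((2 * Real.pi / L) ^ 2 * ∑ i, (k i : ℝ) ^ 2)) ∧
        hMinusOneSqW L Θ₀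
            (fun X : Config N => ∑ j, Real.sin (2 * Real.pi / L * ∑ i, (k i : ℝ) * X j i)) ≤
          ENNReal.ofReal (C * N / ((2 * Real.pi / L) ^ 2 * ∑ i, (k i : ℝ) ^ 2)) := by
  -- adapted from `stub_responseDictionary` / `responseDictionary_sin` (same crux, line healing)
  obtain ⟨ρ₀, hρ₀, C, hC, hK⟩ := hK1 v hv
  refine ⟨ρ₀, hρ₀, C, hC, fun ρ hρ hρ₀' N hN L hLdef hb Θ₀ hΘ hΘc k hk => ?_⟩
  subst hLdef
  obtain ⟨C', hC'⟩ := hb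
  have hL : 0 < sideLength ρ (N + 1) := sideLength_succ_pos hρ N
  -- box bookkeeping: K1 for the bath at density `ρ' = ρN/(N+1)` in the same box
  have hρ' : 0 < ρ * N / (N + 1) := by
    have : (0 : ℝ) < N := by exact_mod_cast hN
    positivity
  have hρ'lt : ρ * N / (N + 1) < ρ₀ := by
    have h1 : ρ * N / (N + 1) < ρ := by
      rw [div_lt_iff₀ (by positivity)]; nlinarith
    exact h1.trans hρ₀'
  have hKL := hK (ρ * N / (N + 1)) hρ' hρ'lt N k hk
  rw [sideLength_bath hρ hN, density_bath hρ N] at hKL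
  set CK : ℝ := C * N / max (N / sideLength ρ (N + 1) ^ 3 * (scatteringLength v).toReal)
    ((2 * Real.pi / sideLength ρ (N + 1)) ^ 2 * ∑ i, (k i : ℝ) ^ 2) with hCK
  have hKcos : ∀ (t : ℝ) (Ψ : PeriodicTrialState N (sideLength ρ (N + 1))),
      periodicEnergy v Ψ ≠ ⊤ →
      (periodicGroundStateEnergy v N (sideLength ρ (N + 1))).toReal - CK * t ^ 2 ≤
        (periodicEnergy v Ψ).toReal + t * ∫ X in cellN N (sideLength ρ (N + 1)),
          (∑ j, Real.cos (2 * Real.pi / sideLength ρ (N + 1) * ∑ i, (k i : ℝ) * X j i)) *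
            ‖Ψ.ψ X‖ ^ 2 := by
    intro t Ψ hΨ
    have h := hKL t Ψ hΨ
    have e : C * t ^ 2 * N / max (N / sideLength ρ (N + 1) ^ 3 * (scatteringLength v).toReal)
        ((2 * Real.pi / sideLength ρ (N + 1)) ^ 2 * ∑ i, (k i : ℝ) ^ 2) = CK * t ^ 2 := by
      rw [hCK]; ring
    rw [e] at h
    exact h
  have hKsin : ∀ (t : ℝ) (Ψ : PeriodicTrialState N (sideLength ρ (N + 1))),
      periodicEnergy v Ψ ≠ ⊤ →
      (periodicGroundStateEnergy v N (sideLength ρ (N + 1))).toReal - CK * t ^ 2 ≤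
        (periodicEnergy v Ψ).toReal + t * ∫ X in cellN N (sideLength ρ (N + 1)),
          (∑ j, Real.sin (2 * Real.pi / sideLength ρ (N + 1) * ∑ i, (k i : ℝ) * X j i)) *
            ‖Ψ.ψ X‖ ^ 2 :=
    fun t Ψ hΨ => staticResponse_sin_of_cos hL hk hKcos t Ψ hΨ
  -- the density waves: continuous, bounded by `N`, permutation symmetric
  have hcont : ∀ f : ℝ → ℝ, Continuous f → Continuous fun X : Config N =>
      ∑ j, f (2 * Real.pi / sideLength ρ (N + 1) * ∑ i, (k i : ℝ) * X j i) := by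
    intro f hf
    refine continuous_finsetSum _ fun j _ => hf.comp (continuous_const.mul
      (continuous_finsetSum _ fun i _ => continuous_const.mul ?_))
    exact (PiLp.continuous_apply 2 _ i).comp (continuous_apply j)
  have hbd : ∀ f : ℝ → ℝ, (∀ x, |f x| ≤ 1) → ∀ X : Config N,
      |∑ j, f (2 * Real.pi / sideLength ρ (N + 1) * ∑ i, (k i : ℝ) * X j i)| ≤ N := by
    intro f hf X
    calc |∑ j, f (2 * Real.pi / sideLength ρ (N + 1) * ∑ i, (k i : ℝ) * X j i)|
        ≤ ∑ j : Fin N, |f (2 * Real.pi / sideLength ρ (N + 1) * ∑ i, (k i : ℝ) * X j i)| :=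
          Finset.abs_sum_le_sum_abs _ _
      _ ≤ ∑ _j : Fin N, (1 : ℝ) := Finset.sum_le_sum fun j _ => hf _
      _ = N := by simp
  have hsymm : ∀ (f : ℝ → ℝ) (σ : Equiv.Perm (Fin N)) (X : Config N),
      (∑ j, f (2 * Real.pi / sideLength ρ (N + 1) * ∑ i, (k i : ℝ) * (X ∘ σ) j i)) =
        ∑ j, f (2 * Real.pi / sideLength ρ (N + 1) * ∑ i, (k i : ℝ) * X j i) := fun f σ X =>
    Equiv.sum_comp σ (fun j => f (2 * Real.pi / sideLength ρ (N + 1) * ∑ i, (k i : ℝ) * X j i))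
  -- `C N / max(ρ'a, |p|²) ≤ C N / |p|²`
  have hp2 : 0 < (2 * Real.pi / sideLength ρ (N + 1)) ^ 2 * ∑ i, (k i : ℝ) ^ 2 := by
    have hk2 : 0 < ∑ i, (k i : ℝ) ^ 2 := by
      obtain ⟨i, hi⟩ : ∃ i, k i ≠ 0 := by
        by_contra h
        push Not at h
        exact hk (funext h)
      have hi' : (0 : ℝ) < (k i : ℝ) ^ 2 := by
        have : (k i : ℝ) ≠ 0 := by exact_mod_cast hi
        positivity
      exact Finset.sum_pos' (fun j _ => sq_nonneg _) ⟨i, Finset.mem_univ _, hi'⟩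
    positivity
  have hmono : ENNReal.ofReal CK ≤ ENNReal.ofReal
      (C * N / ((2 * Real.pi / sideLength ρ (N + 1)) ^ 2 * ∑ i, (k i : ℝ) ^ 2)) := by
    refine ENNReal.ofReal_le_ofReal ?_
    rw [hCK]
    exact div_le_div_of_nonneg_left (by positivity) hp2 (le_max_right _ _)
  exact ⟨(hMinusOneSqW_le_of_fk_staticResponse hv.1 hL hC' hΘ hΘc (hcont _ Real.continuous_cos)
      (hbd _ Real.abs_cos_le_one) (hsymm _) hKcos).trans hmono,
    (hMinusOneSqW_le_of_fk_staticResponse hv.1 hL hC' hΘ hΘc (hcont _ Real.continuous_sin)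
      (hbd _ Real.abs_sin_le_one) (hsymm _) hKsin).trans hmono⟩

/-! ### The elementary lattice sum -/

/-- The sup norm `|k|∞` of `k ∈ ℤ³` vanishes only at `k = 0`. [folklore] -/
theorem one_le_supNorm_of_ne_zero {k : Fin 3 → ℤ} (hk : k ≠ 0) :
    1 ≤ univ.sup fun j => (k j).natAbs := by
  by_contra h
  push Not at h
  have h0 : (univ.sup fun j => (k j).natAbs) = 0 := by omega
  apply hk
  funext j
  have := Finset.sup_eq_bot_iff _ _ |>.1 h0 j (mem_univ j)
  simpa using this

/-- **The elementary lattice bound.** If `|c_k| ≤ A` for all `k` and `∑_{k ∈ T} c_k² ≤ P` for all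
finite `T`, then for `K₀ ≥ 1` and every finite `T ⊂ ℤ³ ∖ {0}`:
`∑_{k ∈ T} c_k² / |k|² ≤ 96 K₀ A² + P / K₀²` — the shells `1 ≤ |k|∞ ≤ K₀` carry at most
`96 K₀` in `∑ |k|∞⁻²` (`sum_inv_supNorm_sq_le`, `|k|² ≥ |k|∞²`), and `|k|² > K₀²` beyond. [folklore] -/
theorem sum_sq_div_nsq_le {c : (Fin 3 → ℤ) → ℝ} {A P : ℝ} (hA : ∀ k, |c k| ≤ A)
    (hP : ∀ T : Finset (Fin 3 → ℤ), ∑ k ∈ T, c k ^ 2 ≤ P) {K₀ : ℕ} (hK₀ : 1 ≤ K₀)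
    (T : Finset (Fin 3 → ℤ)) (hT : (0 : Fin 3 → ℤ) ∉ T) :
    ∑ k ∈ T, c k ^ 2 / ∑ i, (k i : ℝ) ^ 2 ≤ 96 * K₀ * A ^ 2 + P / (K₀ : ℝ) ^ 2 := by
  set s : (Fin 3 → ℤ) → ℕ := fun k => univ.sup fun j => (k j).natAbs with hs
  have hA0 : 0 ≤ A := (abs_nonneg _).trans (hA 0)
  have hP0 : 0 ≤ P := (Finset.sum_empty.symm.le).trans (hP ∅)
  have hne : ∀ k ∈ T, k ≠ 0 := fun k hk h => hT (h ▸ hk)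
  have hs1 : ∀ k ∈ T, 1 ≤ s k := fun k hk => one_le_supNorm_of_ne_zero (hne k hk)
  have hsq : ∀ k, ((s k : ℕ) : ℝ) ^ 2 ≤ ∑ i, (k i : ℝ) ^ 2 := fun k => supNorm_sq_le_nsq k
  have hpos : ∀ k ∈ T, 0 < ∑ i, (k i : ℝ) ^ 2 := fun k hk => by
    have h1 : (1 : ℝ) ≤ ((s k : ℕ) : ℝ) := by exact_mod_cast hs1 k hk
    nlinarith [hsq k]
  have hc2 : ∀ k, c k ^ 2 ≤ A ^ 2 := fun k => by
    rw [← sq_abs]; exact pow_le_pow_left₀ (abs_nonneg _) (hA k) 2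
  rw [← Finset.sum_filter_add_sum_filter_not T (fun k => s k ≤ K₀)]
  refine add_le_add ?_ ?_
  · -- infrared shells `1 ≤ |k|∞ ≤ K₀`
    have hfilt : T.filter (fun k => s k ≤ K₀) = T.filter (fun k => 1 ≤ s k ∧ s k ≤ K₀) :=
      Finset.filter_congr fun k hk => ⟨fun h => ⟨hs1 k hk, h⟩, fun h => h.2⟩
    calc ∑ k ∈ T.filter (fun k => s k ≤ K₀), c k ^ 2 / ∑ i, (k i : ℝ) ^ 2
        ≤ ∑ k ∈ T.filter (fun k => s k ≤ K₀), A ^ 2 * (((s k : ℕ) : ℝ) ^ 2)⁻¹ := by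
          refine Finset.sum_le_sum fun k hk => ?_
          have hkT : k ∈ T := (Finset.mem_filter.1 hk).1
          have hsk : (0 : ℝ) < ((s k : ℕ) : ℝ) ^ 2 := by
            have h1 : (1 : ℝ) ≤ ((s k : ℕ) : ℝ) := by exact_mod_cast hs1 k hkT
            positivity
          rw [div_eq_mul_inv]
          exact mul_le_mul (hc2 k) ((inv_le_inv₀ (hpos k hkT) hsk).2 (hsq k))
            (inv_nonneg.2 (hpos k hkT).le) (sq_nonneg _)
      _ = A ^ 2 * ∑ k ∈ T.filter (fun k => 1 ≤ s k ∧ s k ≤ K₀), (((s k : ℕ) : ℝ) ^ 2)⁻¹ := by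
          rw [Finset.mul_sum, hfilt]
      _ ≤ A ^ 2 * (96 * K₀) :=
          mul_le_mul_of_nonneg_left (sum_inv_supNorm_sq_le T K₀) (sq_nonneg _)
      _ = 96 * K₀ * A ^ 2 := by ring
  · -- ultraviolet modes `|k|∞ > K₀`
    calc ∑ k ∈ T.filter (fun k => ¬ s k ≤ K₀), c k ^ 2 / ∑ i, (k i : ℝ) ^ 2
        ≤ ∑ k ∈ T.filter (fun k => ¬ s k ≤ K₀), c k ^ 2 / (K₀ : ℝ) ^ 2 := by
          refine Finset.sum_le_sum fun k hk => ?_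
          have hk' := (Finset.mem_filter.1 hk).2
          have hK : ((K₀ : ℝ)) ^ 2 ≤ ∑ i, (k i : ℝ) ^ 2 := by
            have h1 : (K₀ : ℝ) ≤ ((s k : ℕ) : ℝ) := by exact_mod_cast (not_le.1 hk').le
            exact (pow_le_pow_left₀ (Nat.cast_nonneg _) h1 2).trans (hsq k)
          exact div_le_div_of_nonneg_left (sq_nonneg _) (by positivity) hK
      _ = (∑ k ∈ T.filter (fun k => ¬ s k ≤ K₀), c k ^ 2) / (K₀ : ℝ) ^ 2 := by
          rw [Finset.sum_div]
      _ ≤ P / (K₀ : ℝ) ^ 2 := div_le_div_of_nonneg_right (hP _) (by positivity)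

end Summit.AtomisticToContinuum.BoseEinsteinCondensation.Theorems.CorrectorClosure.ResidueAreaLaw

end
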